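import Summits.ABC.IUTFork.Repair.Mu6CarrierAtTwo
import Literature.IUT.LogVolume.UnitLogMaxNorm
import HarnessLib

/-!
# R-H ROUND 4, census row O-19 (μ₆ / `v ∣ 2` class), KEY R4MU6-SHARP: the SHARP OUTER-RADIUS FACE `b♯_e := max_a (a − p^a/e) = a₀ − p^{a₀}/e`
# of the real log-shell in place of [IUTchIV] Prop. 1.2's `b_e`, the sharpened 2-adic top-label NEGATIVE cell at ★ p538759, and the v2 row numerals

PROOF-ONLY file (D-0012; 0 definitions, 0 `Prop` facts, no `instance`, no notation) of the abc-iut cell, seat abc-iut-L5-t2 gen 14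
(KEY `wake/KEY-abc-iut-L5-t2-R4MU6-SHARP.md`, abc-iut-rh-lead g6). TAKES NO SIDE on [IUTchIII] Cor. 3.12 / [IUTchIV] Thm. 1.10, on
[ExpEst], or on any author (D-0045); nothing here asserts abc proved or refuted; a kernel inequality at a tabulated ramification index is a
statement about OUR typed face, not about print; typed ≠ inhabited ≠ proved; no `Mu6InitialThetaData` inhabitant is implied or faked.

WHAT `b♯` IS, DEF-FREE. The outer radius of `log_p(𝒪_K^×)` used by the window lemmas of record (rp-d2 `CandInternal2Real*`:
`logShell_ofUnitLog_subset_closedBall`, `height_le_of_mem_pow_smul_logShell`, `not_mem_topLabel_of_large_l`; ★ p538759 §5) is abc-iut-S1's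
[IUTchIV] Prop. 1.2 (i) container `log_p(𝒪_K^×) ⊆ p^{−b_e}·𝒪_K` (`logUnits_subset_pBall_neg_logRadiusB`, `b_e = logRadiusB p e`). The tree
ALREADY holds the EXACT radius (abc-iut-c312-3 gen 9, `Literature/IUT/LogVolume/UnitLogMaxNorm.lean`, namespace `LogEnvelope`): for a
TURNING POINT `a₀` of `e` (`p^a(p−1) < e` for `a < a₀`, `e ≤ p^{a₀}(p−1)`; `exists_turning`) one has `‖log_p u‖ ≤ ‖ϖ‖^{p^{a₀} − e·a₀}` for
every `u` (`logUnits_subset_closedBall_envelope`), the bound is ATTAINED off the cyclotomic indices `e = p^a(p−1)` (`isGreatest_norm_logUnits`),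
and `a₀` minimises `a ↦ p^a − e·a` (`RamificationCriterion.exponent_min`). In `p^λ` form (`‖ϖ‖ = p^{−1/e}`) this is
`log_p(𝒪_K^×) ⊆ p^{−b♯}·𝒪_K`, **`b♯ := a₀ − p^{a₀}/e = max_a (a − p^a/e)`** — the KEY's `max_{k ≥ 1}(k − 2^k/e)` at `p = 2`, where the
turning point of `e` is the `a₀` with `2^{a₀−1} < e ≤ 2^{a₀}`. So NO new definition is needed: every statement below spells `b♯` as the real
number `(a₀ : ℝ) − p^{a₀}/e` under the two turning inequalities (decidable integer comparisons that pin `a₀ = a₀(e)`; no structure), or — in the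
`a₀`-free form — as the hypothesis `∀ a, … (a − p^a/e) …` (equivalent by `exponent_min`). FROZEN FACT-LIST f75a60bac22efdb6 untouched.

RESULTS (`K` complete, nontrivially ultrametric-normed over `ℚ_p`, `ProperSpace K`; `e = absRamificationIdx p K`; `c = ord_p(p*)`).
* §1 `norm_zpow_envelope_eq_rpow` (`‖ϖ‖^{p^{a₀} − e·a₀} = p^{a₀ − p^{a₀}/e}`); **`logUnits_subset_pBall_neg_sharp`**: `log_p(𝒪_K^×) ⊆ p^{−b♯}·𝒪_K`
  (the S1 container with the exact exponent, BY NAME from the envelope); `logUnits_subset_pBall_neg_iff_sharp`: at a strict turning point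
  `log_p(𝒪_K^×) ⊆ p^{−B}·𝒪_K ⟺ b♯ ≤ B` — NO norm-only face can use a smaller outer radius; `sharpExponent_le_logRadiusB`: `b♯ ≤ b_e`
  (so every sharp cell below IMPLIES the corresponding cell of record: decided rows stay decided).
* §2 the sharp window (mirror of p450037 / p451037 with `b♯` for `b_e`): `logShell_ofUnitLog_subset_closedBall_sharp`
  (`ℐ_K ⊆ {‖z‖ ≤ ‖p*‖⁻¹·p^{b♯}}`), `height_le_of_mem_pow_smul_logShell_sharp` (`q ∈ q^n·ℐ_K ⟹ (n−1)·h ≤ b♯ + c`),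
  `not_mem_pow_smul_logShell_of_lt_sharp`, `…_of_root_lt_sharp`, **`not_mem_topLabel_of_large_l_sharp`** (`8l·(b♯ + c) < (l−3)(l+1)·H ⟹
  q̲ ∉ q̲^{l⋇²}·ℐ_K`) and its `a₀`-free twin `not_mem_topLabel_of_forall_lt`.
* §3 `p = 2`: `turning_two` (`2^k < e ≤ 2^{k+1}` ⟹ `k+1` is the turning point); at the μ₆ carrier `X₆` of ★ p538759, `K_w := kOf X₆ 2 x`:
  **`twoAdic_not_mem_topLabel_of_large_l_sharp`** — same statement as `Mu6CarrierAtTwo.twoAdic_not_mem_topLabel_of_large_l` (l. 262) with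
  `b♯_{e_w} = a₀ − 2^{a₀}/e_w` in `hlt`: `8l·(b♯_{e_w} + 2) < (l−3)(l+1)·H ⟹ q ∉ q^{l⋇²}·ℐ_{K_w}`; `a₀`-free form `…_of_forall_lt`; height form
  `twoAdic_not_mem_of_lt_sharp`; `twoAdic_hlt_sharp_of_hlt` (the face of record implies the sharp face's hypothesis).
* §4 ROW NUMERALS of the desk sign table v2 (ROUND4/R4-OBJ-MU6-INST-L5-t2.v2.tsv; bracket `e_w ∈ {e₀, 2e₀}` of the v1 memo aeabb17b3536215f,
  decided = holds at BOTH ends): the 5 rows that FLIP undecided → NEG-decided — `(H, l) = (2, 53)` (three `v₂(abc) = 5` triples; `e₀ = 1590`):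
  `hlt_sharp_H2_l53` + the field-level theorem `not_mem_topLabel_H2_l53` (ANY 2-adic `K` with `e ∈ {1590, 3180}`, ANY `q` with
  `‖q‖^{106} = 2^{−2}`: `q ∉ q^{26²}·ℐ_K`); `(H, l) = (8, 13)` (two triples; `e₀ = 390`): `hlt_sharp_H8_l13`, `not_mem_topLabel_H8_l13`
  (`e ∈ {390, 780}`, `‖q‖^{26} = 2^{−8}` ⟹ `q ∉ q^{36}·ℐ_K`); the 2 rows that become BRACKET-DEPENDENT (sharp `hlt` at `e₀`, NOT at `2e₀`;
  undecided per the desk's rule (S2)): `hlt_sharp_bracketDependent` (`(H, l, e₀) = (6, 13, 130)`, `(16, 7, 210)`); and one row that STAYS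
  undecided at both ends: `not_hlt_sharp_bigFrey_l13` (`H = 2`, `l = 13`, `e = 390`: `8·13·(b♯₃₉₀ + 2) = 1007.4… ≮ 280`).
Classical `p`-adic analysis; [cite: NeukirchANT1999, Ch. II (5.5)] (envelope); [cite: MochizukiAbsTopIII2015, Def 5.4 (iii) p. 126] (`ℐ_K`);
[claim: Mochizuki2012, status: disputed] / [claim: MochizukiEtAl2022, status: disputed] for every IUT / [ExpEst] locution (Prop. 1.2 p. 10; Def. 4.1 p. 201).
-/

noncomputable section

open Set Metric Function
open scoped Pointwise
namespace Summit.ABC.IUTFork.Repair.Mu6TwoAdicSharpFace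
open Literature.IUT.LogVolume Literature.IUT.LogVolume.LogEnvelope Literature.IUT.LogVolume.RamificationCriterion
  Literature.NumberTheory.GaloisRepresentations.Ultrametric Literature.AnabelianGeometry.AbsoluteAnabelian
  Literature.IUT.LogThetaLattice Literature.IUT.HodgeTheaters
  Summit.ABC.IUTFork.Repair.CandInternal2Real Summit.ABC.IUTFork.Repair.CandInternal2RealLabels
  Summit.ABC.IUTFork.Repair.CandInternal2RealStrata Summit.ABC.IUTFork.Repair.Mu6CarrierAtTwo
  Summit.ABC.IUTFork.Thm311 Summit.ABC.IUTFork.Thm311.Real Summit.ABC.IUTFork.Cor312Prov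

/-! ## §1. The sharp outer exponent `b♯ = a₀ − p^{a₀}/e` of `log_p(𝒪_K^×)` in `p^λ` form (envelope of `UnitLogMaxNorm` BY NAME) -/

section General
variable (p : ℕ) [Fact p.Prime]
variable (K : Type*) [NontriviallyNormedField K] [NormedAlgebra ℚ_[p] K] [IsUltrametricDist K] [ProperSpace K]

/-- **`‖ϖ‖^{p^{a₀} − e·a₀} = p^{a₀ − p^{a₀}/e}`** (`‖ϖ‖ = p^{−1/e}`, `norm_eq_rpow_of_isUniformizer`): the envelope radius of
`UnitLogMaxNorm` as a `p`-power with exponent `b♯ := a₀ − p^{a₀}/e`. [cite: NeukirchANT1999, Ch. II (5.5)] -/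
theorem norm_zpow_envelope_eq_rpow {ϖ : Kˣ} (hϖ : IsUniformizer ϖ) (a₀ : ℕ) :
    ‖(ϖ : K)‖ ^ ((p : ℤ) ^ a₀ - (absRamificationIdx p K : ℤ) * (a₀ : ℤ)) =
      (p : ℝ) ^ ((a₀ : ℝ) - (p : ℝ) ^ a₀ / (absRamificationIdx p K : ℝ)) := by
  have hp0 : (0 : ℝ) ≤ p := by positivity
  have he : (absRamificationIdx p K : ℝ) ≠ 0 := by exact_mod_cast (absRamificationIdx_pos p K).ne'
  rw [norm_eq_rpow_of_isUniformizer p K hϖ, ← Real.rpow_intCast, ← Real.rpow_mul hp0]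
  congr 1
  push_cast
  field_simp
  ring

/-- **SHARP UPPER INCLUSION `log_p(𝒪_K^×) ⊆ p^{−b♯}·𝒪_K`**, `b♯ = a₀ − p^{a₀}/e` for a turning point `a₀` of `e` — abc-iut-S1's
`logUnits_subset_pBall_neg_logRadiusB` with [IUTchIV] Prop. 1.2's `b_e` replaced by the EXACT exponent, BY NAME from abc-iut-c312-3's
`LogEnvelope.logUnits_subset_closedBall_envelope` (at the chosen uniformizer `unifChoice K`). [cite: NeukirchANT1999, Ch. II (5.5)] -/
theorem logUnits_subset_pBall_neg_sharp {a₀ : ℕ}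
    (hlo : ∀ a < a₀, (p : ℤ) ^ a * ((p : ℤ) - 1) < absRamificationIdx p K)
    (hhi : (absRamificationIdx p K : ℤ) ≤ (p : ℤ) ^ a₀ * ((p : ℤ) - 1)) :
    logUnits K ⊆ pBall p K (-((a₀ : ℝ) - (p : ℝ) ^ a₀ / (absRamificationIdx p K : ℝ))) := by
  intro z hz
  rw [mem_pBall_iff, neg_neg, ← norm_zpow_envelope_eq_rpow p K (isUniformizer_unifChoice K) a₀]
  exact mem_closedBall_zero_iff.mp (logUnits_subset_closedBall_envelope p (isUniformizer_unifChoice K) hlo hhi hz)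

omit [Fact p.Prime] [NormedAlgebra ℚ_[p] K] [IsUltrametricDist K] [ProperSpace K] in
/-- `p^{−B}·𝒪_K` is the closed ball of radius `p^{B}`. [folklore] -/
theorem pBall_neg_eq_closedBall (B : ℝ) : pBall p K (-B) = closedBall (0 : K) ((p : ℝ) ^ B) := by
  ext z
  rw [mem_pBall_iff, neg_neg, mem_closedBall_zero_iff]

/-- **The sharp exponent is OPTIMAL among norm faces**: at a STRICT turning point (`e < p^{a₀}(p−1)`, i.e. `e` is not a cyclotomic index
`p^a(p−1)`), `log_p(𝒪_K^×) ⊆ p^{−B}·𝒪_K ⟺ b♯ ≤ B` (`LogEnvelope.logUnits_subset_closedBall_iff`: the envelope radius is attained at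
`log_p(1 + ϖ)`). Hence no outer-radius face with an exponent below `b♯` exists. [cite: NeukirchANT1999, Ch. II (5.5)] -/
theorem logUnits_subset_pBall_neg_iff_sharp {a₀ : ℕ}
    (hlo : ∀ a < a₀, (p : ℤ) ^ a * ((p : ℤ) - 1) < absRamificationIdx p K)
    (hhi : (absRamificationIdx p K : ℤ) < (p : ℤ) ^ a₀ * ((p : ℤ) - 1)) {B : ℝ} :
    logUnits K ⊆ pBall p K (-B) ↔ (a₀ : ℝ) - (p : ℝ) ^ a₀ / (absRamificationIdx p K : ℝ) ≤ B := by
  have hp1 : (1 : ℝ) < p := by exact_mod_cast (Fact.out : p.Prime).one_lt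
  rw [pBall_neg_eq_closedBall, logUnits_subset_closedBall_iff p (isUniformizer_unifChoice K) hlo hhi,
    norm_zpow_envelope_eq_rpow p K (isUniformizer_unifChoice K) a₀, Real.rpow_le_rpow_left_iff hp1]

omit [IsUltrametricDist K] [ProperSpace K] in
/-- **`b♯ ≤ b_e`**: for a turning point `a₀` of `e ≥ 1`, `a₀ − p^{a₀}/e ≤ logRadiusB p e = ⌊log(pe/(p−1))/log p⌋ − 1/e` (`a₀ ≤ ⌊·⌋` because
`p^{a₀−1}(p−1) < e` gives `p^{a₀} ≤ pe/(p−1)`, and `p^{a₀} ≥ 1`). Every sharp negative cell below therefore CONTAINS the cell of record.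
[claim: Mochizuki2012, status: disputed] -/
theorem sharpExponent_le_logRadiusB {e a₀ : ℕ} (he : 1 ≤ e) (hlo : ∀ a < a₀, (p : ℤ) ^ a * ((p : ℤ) - 1) < e) :
    (a₀ : ℝ) - (p : ℝ) ^ a₀ / (e : ℝ) ≤ logRadiusB p e := by
  have hP : p.Prime := Fact.out
  have hp1 : (1 : ℝ) < p := by exact_mod_cast hP.one_lt
  have hp0 : (0 : ℝ) < p := by linarith
  have hp1' : (0 : ℝ) < (p : ℝ) - 1 := by linarith
  have he' : (0 : ℝ) < e := by exact_mod_cast he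
  set x : ℝ := (p : ℝ) * e / ((p : ℝ) - 1) with hx
  have hx0 : 0 < x := div_pos (mul_pos hp0 he') hp1'
  -- `p^{a₀} ≤ x`, i.e. `p^{a₀}·(p−1) ≤ p·e`
  have hpow : (p : ℝ) ^ a₀ ≤ x := by
    rw [hx, le_div_iff₀ hp1']
    rcases Nat.eq_zero_or_pos a₀ with h0 | h0
    · subst h0
      have : (1 : ℝ) ≤ e := by exact_mod_cast he
      nlinarith
    · obtain ⟨a, rfl⟩ : ∃ a, a₀ = a + 1 := ⟨a₀ - 1, by omega⟩
      have h := hlo a (by omega)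
      have h' : (p : ℝ) ^ a * ((p : ℝ) - 1) < e := by exact_mod_cast h
      rw [pow_succ]
      nlinarith
  have hfloor : (a₀ : ℤ) ≤ ⌊Real.log x / Real.log p⌋ := by
    rw [Int.le_floor, Int.cast_natCast, Real.log_div_log, Real.le_logb_iff_rpow_le hp1 hx0, Real.rpow_natCast]
    exact hpow
  have hfloor' : (a₀ : ℝ) ≤ (⌊Real.log x / Real.log p⌋ : ℝ) := by exact_mod_cast hfloor
  have hone : (1 : ℝ) / e ≤ (p : ℝ) ^ a₀ / e := by
    gcongr
    exact one_le_pow₀ hp1.le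
  rw [logRadiusB, ← hx]
  linarith

/-- **`a₀` MAXIMISES `a ↦ a − p^a/e`** (`RamificationCriterion.exponent_min`): `b♯ = max_a (a − p^a/e)`, the KEY's `max_k (k − 2^k/e)` at
`p = 2`. [cite: NeukirchANT1999, Ch. II (5.5)] -/
theorem sub_pow_div_le_sharpExponent {e a₀ : ℕ} (he : 1 ≤ e) (hlo : ∀ a < a₀, (p : ℤ) ^ a * ((p : ℤ) - 1) < e)
    (hhi : (e : ℤ) ≤ (p : ℤ) ^ a₀ * ((p : ℤ) - 1)) (a : ℕ) :
    (a : ℝ) - (p : ℝ) ^ a / (e : ℝ) ≤ (a₀ : ℝ) - (p : ℝ) ^ a₀ / (e : ℝ) := by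
  have hP : (2 : ℤ) ≤ (p : ℤ) := by exact_mod_cast (Fact.out : p.Prime).two_le
  have h := exponent_min (S := 1) (P := (p : ℤ)) (E := (e : ℤ)) (a₀ := a₀) le_rfl hP
    (fun b hb => by rw [one_mul]; exact hlo b hb) (by rw [one_mul]; exact hhi) a
  rw [one_mul, one_mul] at h
  have h' : (p : ℝ) ^ a₀ - (e : ℝ) * a₀ ≤ (p : ℝ) ^ a - (e : ℝ) * a := by exact_mod_cast h
  have he' : (0 : ℝ) < e := by exact_mod_cast he
  have key : ((a : ℝ) - (p : ℝ) ^ a / (e : ℝ)) - ((a₀ : ℝ) - (p : ℝ) ^ a₀ / (e : ℝ))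
      = ((p : ℝ) ^ a₀ - (e : ℝ) * a₀ - ((p : ℝ) ^ a - (e : ℝ) * a)) / e := by
    field_simp
    ring
  have hnp : ((p : ℝ) ^ a₀ - (e : ℝ) * a₀ - ((p : ℝ) ^ a - (e : ℝ) * a)) / e ≤ 0 :=
    div_nonpos_of_nonpos_of_nonneg (by linarith) he'.le
  linarith [key]

/-! ## §2. The SHARP label window: rp-d2's chain (`CandInternal2Real` / `…Labels` / `…Strata`) with `b♯` in place of `b_e` -/

/-- **The real log-shell lies in the ball of radius `‖p*‖⁻¹ · p^{b♯}`** (`ℐ_K = (p*)⁻¹·log_p(𝒪_K^×)`, `logShell_ofUnitLog`, and §1) — the sharp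
twin of `CandInternal2Real.logShell_ofUnitLog_subset_closedBall`. [cite: MochizukiAbsTopIII2015, Def 5.4 (iii) p. 126] -/
theorem logShell_ofUnitLog_subset_closedBall_sharp {a₀ : ℕ}
    (hlo : ∀ a < a₀, (p : ℤ) ^ a * ((p : ℤ) - 1) < absRamificationIdx p K)
    (hhi : (absRamificationIdx p K : ℤ) ≤ (p : ℤ) ^ a₀ * ((p : ℤ) - 1)) :
    logShell (PadicLogOnUnits.ofUnitLog p K) ⊆
      closedBall (0 : K) (‖((p ^ (if p = 2 then 2 else 1) : ℕ) : K)‖⁻¹ *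
        (p : ℝ) ^ ((a₀ : ℝ) - (p : ℝ) ^ a₀ / (absRamificationIdx p K : ℝ))) := by
  rw [logShell_ofUnitLog]
  rintro _ ⟨y, hy, rfl⟩
  have hyb : ‖y‖ ≤ (p : ℝ) ^ ((a₀ : ℝ) - (p : ℝ) ^ a₀ / (absRamificationIdx p K : ℝ)) := by
    have := (mem_pBall_iff p K).1 (logUnits_subset_pBall_neg_sharp p K hlo hhi hy)
    rwa [neg_neg] at this
  rw [mem_closedBall, dist_zero_right]
  show ‖((p ^ (if p = 2 then 2 else 1) : ℕ) : K)⁻¹ • y‖ ≤ _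
  rw [smul_eq_mul, norm_mul, norm_inv]
  exact mul_le_mul_of_nonneg_left hyb (inv_nonneg.2 (norm_nonneg _))

/-- **SHARP WINDOW, upper edge**: `q ∈ q^n · ℐ_K ⟹ (n−1)·h ≤ b♯ + c` (`‖q‖ = p^{−h}`, `c = ord_p(p*)`) — the sharp twin of
`CandInternal2RealLabels.height_le_of_mem_pow_smul_logShell`. [cite: MochizukiAbsTopIII2015, Def 5.4 (iii) p. 126] -/
theorem height_le_of_mem_pow_smul_logShell_sharp {a₀ : ℕ}
    (hlo : ∀ a < a₀, (p : ℤ) ^ a * ((p : ℤ) - 1) < absRamificationIdx p K)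
    (hhi : (absRamificationIdx p K : ℤ) ≤ (p : ℤ) ^ a₀ * ((p : ℤ) - 1)) {q : K} {h : ℝ} (hqh : ‖q‖ = (p : ℝ) ^ (-h)) {n : ℕ}
    (hmem : q ∈ q ^ n • logShell (PadicLogOnUnits.ofUnitLog p K)) :
    ((n : ℝ) - 1) * h ≤ ((a₀ : ℝ) - (p : ℝ) ^ a₀ / (absRamificationIdx p K : ℝ)) + ((if p = 2 then 2 else 1 : ℕ) : ℝ) := by
  have hle := norm_le_of_mem_pow_smul (logShell_ofUnitLog_subset_closedBall_sharp p K hlo hhi) hmem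
  have hp1 : (1 : ℝ) < p := by exact_mod_cast (Fact.out : p.Prime).one_lt
  have hp0 : (0 : ℝ) < p := by linarith
  rw [norm_pstar_inv_eq_rpow p K, hqh, ← Real.rpow_natCast, ← Real.rpow_mul hp0.le, ← Real.rpow_add hp0, ← Real.rpow_add hp0,
    Real.rpow_le_rpow_left_iff hp1] at hle
  linarith

/-- **SHARP NEGATIVE CELL, height form**: `b♯ + c < (n−1)·h ⟹ q ∉ q^n · ℐ_K`. [cite: MochizukiAbsTopIII2015, Def 5.4 (iii) p. 126] -/
theorem not_mem_pow_smul_logShell_of_lt_sharp {a₀ : ℕ}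
    (hlo : ∀ a < a₀, (p : ℤ) ^ a * ((p : ℤ) - 1) < absRamificationIdx p K)
    (hhi : (absRamificationIdx p K : ℤ) ≤ (p : ℤ) ^ a₀ * ((p : ℤ) - 1)) {q : K} {h : ℝ} (hqh : ‖q‖ = (p : ℝ) ^ (-h)) {n : ℕ}
    (hlt : ((a₀ : ℝ) - (p : ℝ) ^ a₀ / (absRamificationIdx p K : ℝ)) + ((if p = 2 then 2 else 1 : ℕ) : ℝ) < ((n : ℝ) - 1) * h) :
    q ∉ q ^ n • logShell (PadicLogOnUnits.ofUnitLog p K) := fun hmem =>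
  (not_le.2 hlt) (height_le_of_mem_pow_smul_logShell_sharp p K hlo hhi hqh hmem)

/-- **SHARP NEGATIVE CELL, root form** (`‖q̲‖^N = p^{−H}`): `N·(b♯ + c) < (n−1)·H ⟹ q̲ ∉ q̲^n · ℐ_K`.
[cite: MochizukiAbsTopIII2015, Def 5.4 (iii) p. 126] -/
theorem not_mem_pow_smul_logShell_of_root_lt_sharp {a₀ : ℕ}
    (hlo : ∀ a < a₀, (p : ℤ) ^ a * ((p : ℤ) - 1) < absRamificationIdx p K)
    (hhi : (absRamificationIdx p K : ℤ) ≤ (p : ℤ) ^ a₀ * ((p : ℤ) - 1)) {q : K} {N : ℕ} (hN : 0 < N) {H : ℝ}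
    (hqN : ‖q‖ ^ N = (p : ℝ) ^ (-H)) {n : ℕ}
    (hlt : (N : ℝ) * (((a₀ : ℝ) - (p : ℝ) ^ a₀ / (absRamificationIdx p K : ℝ)) + ((if p = 2 then 2 else 1 : ℕ) : ℝ)) <
      ((n : ℝ) - 1) * H) :
    q ∉ q ^ n • logShell (PadicLogOnUnits.ofUnitLog p K) := fun hmem => by
  have h1 := height_le_of_mem_pow_smul_logShell_sharp p K hlo hhi (norm_eq_rpow_of_pow_eq p (Nat.pos_iff_ne_zero.1 hN) hqN) hmem
  have hN' : (0 : ℝ) < N := by exact_mod_cast hN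
  rw [← mul_div_assoc, div_le_iff₀ hN'] at h1
  exact (not_le.2 hlt) (by linarith)

/-- **SHARP TOP-LABEL NEGATIVE** (`l = 2k+1`, `l⋇ = k`, `‖q̲‖^{2l} = p^{−H}`): `8l·(b♯ + c) < (l−3)(l+1)·H ⟹ q̲ ∉ q̲^{l⋇²} · ℐ_K` — the sharp
twin of `CandInternal2RealStrata.not_mem_topLabel_of_large_l` (same composition, `top_label_identity`). [claim: Mochizuki2012, status: disputed] -/
theorem not_mem_topLabel_of_large_l_sharp {a₀ : ℕ}
    (hlo : ∀ a < a₀, (p : ℤ) ^ a * ((p : ℤ) - 1) < absRamificationIdx p K)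
    (hhi : (absRamificationIdx p K : ℤ) ≤ (p : ℤ) ^ a₀ * ((p : ℤ) - 1)) {q : K} (k : ℕ) {H : ℝ}
    (hqN : ‖q‖ ^ (2 * (2 * k + 1)) = (p : ℝ) ^ (-H))
    (hlt : 8 * ((2 * k + 1 : ℕ) : ℝ) * (((a₀ : ℝ) - (p : ℝ) ^ a₀ / (absRamificationIdx p K : ℝ)) + ((if p = 2 then 2 else 1 : ℕ) : ℝ)) <
      ((((2 * k + 1 : ℕ) : ℝ)) - 3) * (((2 * k + 1 : ℕ) : ℝ) + 1) * H) :
    q ∉ q ^ (k ^ 2) • logShell (PadicLogOnUnits.ofUnitLog p K) := by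
  refine not_mem_pow_smul_logShell_of_root_lt_sharp p K hlo hhi (N := 2 * (2 * k + 1)) (by omega) hqN ?_
  rw [top_label_identity] at hlt
  push_cast at hlt ⊢
  linarith

/-- **SHARP TOP-LABEL NEGATIVE, `a₀`-free form**: the hypothesis `∀ a, 8l·((a − p^a/e) + c) < (l−3)(l+1)·H` IS `8l·(b♯ + c) < (l−3)(l+1)·H`
(`b♯ = max_a (a − p^a/e)`, `sub_pow_div_le_sharpExponent`); a turning point exists (`LogEnvelope.exists_turning`), so no `a₀` need be named.
[claim: Mochizuki2012, status: disputed] -/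
theorem not_mem_topLabel_of_forall_lt {q : K} (k : ℕ) {H : ℝ} (hqN : ‖q‖ ^ (2 * (2 * k + 1)) = (p : ℝ) ^ (-H))
    (hlt : ∀ a : ℕ, 8 * ((2 * k + 1 : ℕ) : ℝ) * (((a : ℝ) - (p : ℝ) ^ a / (absRamificationIdx p K : ℝ)) + ((if p = 2 then 2 else 1 : ℕ) : ℝ)) <
      ((((2 * k + 1 : ℕ) : ℝ)) - 3) * (((2 * k + 1 : ℕ) : ℝ) + 1) * H) :
    q ∉ q ^ (k ^ 2) • logShell (PadicLogOnUnits.ofUnitLog p K) := by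
  obtain ⟨a₀, hlo, hhi⟩ := exists_turning (p := p) (absRamificationIdx p K)
  exact not_mem_topLabel_of_large_l_sharp p K hlo hhi k hqN (hlt a₀)

end General

/-! ## §3. `p = 2`: the turning point in closed form, and the sharp cells at the μ₆ carrier `X₆ = pilotDataOfMu6K D₆ K` of ★ p538759 -/

section TurningTwo
/-- **At `p = 2` the turning point of `e` is the `a₀ = k + 1` with `2^k < e ≤ 2^{k+1}`** (increments `2^a·(2−1) = 2^a`; one step below suffices,
`LogEnvelope.forall_lt_of_pred_lt`); then `b♯_e = (k+1) − 2^{k+1}/e`. [cite: NeukirchANT1999, Ch. II (5.5)] -/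
theorem turning_two {e k : ℕ} (h1 : 2 ^ k < e) (h2 : e ≤ 2 ^ (k + 1)) :
    (∀ a < k + 1, (2 : ℤ) ^ a * ((2 : ℤ) - 1) < e) ∧ ((e : ℤ) ≤ (2 : ℤ) ^ (k + 1) * ((2 : ℤ) - 1)) := by
  refine ⟨fun a ha => ?_, ?_⟩
  · have h := forall_lt_of_pred_lt (p := 2) (a₀ := k + 1) (e := e) (fun b hb => ?_) a ha
    · simpa using h
    · obtain rfl : b = k := by omega
      have : ((2 ^ b : ℕ) : ℤ) < (e : ℤ) := by exact_mod_cast h1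
      push_cast at this ⊢
      linarith
  · have : (e : ℤ) ≤ ((2 ^ (k + 1) : ℕ) : ℤ) := by exact_mod_cast h2
    push_cast at this
    linarith

end TurningTwo
section TwoAdicCells
variable {F K Fbar : Type} [Field F] [NumberField F] [Field K] [NumberField K] [Algebra F K] [Field Fbar]
  [Algebra F Fbar] [Algebra K Fbar] {E : WeierstrassCurve F} [E.IsElliptic] {l : ℕ} {P : BadPlacePredicates K}
variable (D : Mu6InitialThetaData F K Fbar E l P) (x : (thetaIndex (pilotDataOfMu6K D K)).Fibre (.inr (ratPrime 2)))

/-- **SHARP 2-ADIC TOP-LABEL NEGATIVE CELL at the μ₆ carrier** — the statement of `Mu6CarrierAtTwo.twoAdic_not_mem_topLabel_of_large_l` (★ p538759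
l. 262) with `b_{e_w}` replaced by the sharp exponent `b♯_{e_w} = a₀ − 2^{a₀}/e_w` (`a₀` the turning point of `e_w`: `2^{a₀−1} < e_w ≤ 2^{a₀}`) in
`hlt`: for every `q ∈ K_w := kOf X₆ 2 x` with `‖q‖^{2l} = 2^{−H}`, **`8l·(b♯_{e_w} + 2) < (l−3)(l+1)·H ⟹ q ∉ q^{l⋇²}·ℐ_{K_w}`**. Beyond ★ p538759's
hypotheses only the numeric inequality in `b♯` (with the two integer comparisons pinning `a₀`) is assumed. [cite: MochizukiAbsTopIII2015, Def 5.4 (iii) p. 126] -/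
theorem twoAdic_not_mem_topLabel_of_large_l_sharp {q : kOf (pilotDataOfMu6K D K) 2 x} {H : ℝ}
    (hqN : ‖q‖ ^ (2 * l) = ((2 : ℕ) : ℝ) ^ (-H)) {a₀ : ℕ}
    (hlo : ∀ a < a₀, (2 : ℤ) ^ a * ((2 : ℤ) - 1) < absRamificationIdx 2 (kOf (pilotDataOfMu6K D K) 2 x))
    (hhi : (absRamificationIdx 2 (kOf (pilotDataOfMu6K D K) 2 x) : ℤ) ≤ (2 : ℤ) ^ a₀ * ((2 : ℤ) - 1))
    (hlt : 8 * (l : ℝ) * (((a₀ : ℝ) - (2 : ℝ) ^ a₀ / (absRamificationIdx 2 (kOf (pilotDataOfMu6K D K) 2 x) : ℝ)) + 2) <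
      ((l : ℝ) - 3) * ((l : ℝ) + 1) * H) :
    q ∉ q ^ ((pilotDataOfMu6K D K).lstar ^ 2) • logShell (PadicLogOnUnits.ofUnitLog 2 (kOf (pilotDataOfMu6K D K) 2 x)) := by
  have hl : l = 2 * (pilotDataOfMu6K D K).lstar + 1 := (pilotDataOfMu6K D K).l_eq
  refine not_mem_topLabel_of_large_l_sharp 2 (kOf (pilotDataOfMu6K D K) 2 x) hlo hhi (pilotDataOfMu6K D K).lstar
    (by rw [← hl]; exact hqN) ?_
  rw [pstarExp_two, show ((2 * (pilotDataOfMu6K D K).lstar + 1 : ℕ) : ℝ) = (l : ℝ) by exact_mod_cast hl.symm, Nat.cast_ofNat]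
  exact hlt

/-- **The same, `a₀`-free**: `(∀ a, 8l·((a − 2^a/e_w) + 2) < (l−3)(l+1)·H) ⟹ q ∉ q^{l⋇²}·ℐ_{K_w}` — literally «`8l·(b♯_{e_w} + 2) < (l−3)(l+1)·H`»
with `b♯ = max_a (a − 2^a/e)` and NO auxiliary integer. [cite: MochizukiAbsTopIII2015, Def 5.4 (iii) p. 126] -/
theorem twoAdic_not_mem_topLabel_of_forall_lt {q : kOf (pilotDataOfMu6K D K) 2 x} {H : ℝ}
    (hqN : ‖q‖ ^ (2 * l) = ((2 : ℕ) : ℝ) ^ (-H))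
    (hlt : ∀ a : ℕ, 8 * (l : ℝ) * (((a : ℝ) - (2 : ℝ) ^ a / (absRamificationIdx 2 (kOf (pilotDataOfMu6K D K) 2 x) : ℝ)) + 2) <
      ((l : ℝ) - 3) * ((l : ℝ) + 1) * H) :
    q ∉ q ^ ((pilotDataOfMu6K D K).lstar ^ 2) • logShell (PadicLogOnUnits.ofUnitLog 2 (kOf (pilotDataOfMu6K D K) 2 x)) := by
  obtain ⟨a₀, hlo, hhi⟩ := exists_turning (p := 2) (absRamificationIdx 2 (kOf (pilotDataOfMu6K D K) 2 x))
  exact twoAdic_not_mem_topLabel_of_large_l_sharp D x hqN hlo hhi (hlt a₀)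

/-- **SHARP 2-ADIC NEGATIVE CELL, height form**: `2 + b♯_{e_w} < (n−1)·h ⟹ q ∉ qⁿ·ℐ_{K_w}` (`‖q‖ = 2^{−h}`) — the sharp twin of
`Mu6CarrierAtTwo.twoAdic_not_mem_of_lt`. [cite: MochizukiAbsTopIII2015, Def 5.4 (iii) p. 126] -/
theorem twoAdic_not_mem_of_lt_sharp {q : kOf (pilotDataOfMu6K D K) 2 x} {h : ℝ} (hqh : ‖q‖ = ((2 : ℕ) : ℝ) ^ (-h)) {a₀ : ℕ}
    (hlo : ∀ a < a₀, (2 : ℤ) ^ a * ((2 : ℤ) - 1) < absRamificationIdx 2 (kOf (pilotDataOfMu6K D K) 2 x))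
    (hhi : (absRamificationIdx 2 (kOf (pilotDataOfMu6K D K) 2 x) : ℤ) ≤ (2 : ℤ) ^ a₀ * ((2 : ℤ) - 1)) {n : ℕ}
    (hlt : 2 + ((a₀ : ℝ) - (2 : ℝ) ^ a₀ / (absRamificationIdx 2 (kOf (pilotDataOfMu6K D K) 2 x) : ℝ)) < ((n : ℝ) - 1) * h) :
    q ∉ q ^ n • logShell (PadicLogOnUnits.ofUnitLog 2 (kOf (pilotDataOfMu6K D K) 2 x)) := by
  refine not_mem_pow_smul_logShell_of_lt_sharp 2 (kOf (pilotDataOfMu6K D K) 2 x) hlo hhi hqh ?_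
  rw [pstarExp_two, Nat.cast_ofNat]
  linarith

/-- **The face of record implies the sharp face's hypothesis** (`b♯_{e_w} ≤ b_{e_w}`, `sharpExponent_le_logRadiusB`): every (triple, l) decided NEG by
★ p538759 l. 262 is decided NEG by the sharp cell — the v2 sign table can only ADD decided rows. [claim: Mochizuki2012, status: disputed] -/
theorem twoAdic_hlt_sharp_of_hlt {H : ℝ} {a₀ : ℕ}
    (hlo : ∀ a < a₀, (2 : ℤ) ^ a * ((2 : ℤ) - 1) < absRamificationIdx 2 (kOf (pilotDataOfMu6K D K) 2 x))
    (hlt : 8 * (l : ℝ) * (logRadiusB 2 (absRamificationIdx 2 (kOf (pilotDataOfMu6K D K) 2 x)) + 2) < ((l : ℝ) - 3) * ((l : ℝ) + 1) * H) :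
    8 * (l : ℝ) * (((a₀ : ℝ) - (2 : ℝ) ^ a₀ / (absRamificationIdx 2 (kOf (pilotDataOfMu6K D K) 2 x) : ℝ)) + 2) <
      ((l : ℝ) - 3) * ((l : ℝ) + 1) * H := by
  have hle := sharpExponent_le_logRadiusB 2 (absRamificationIdx_pos 2 (kOf (pilotDataOfMu6K D K) 2 x)) hlo
  rw [Nat.cast_ofNat] at hle
  have hl0 : (0 : ℝ) ≤ 8 * (l : ℝ) := by positivity
  nlinarith

end TwoAdicCells

/-! ## §4. ROW NUMERALS of the sign table v2 (bracket `e_w ∈ {e₀, 2e₀}`; decided = the sharp inequality at BOTH ends) -/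

section Rows
variable (K : Type*) [NontriviallyNormedField K] [NormedAlgebra ℚ_[2] K] [IsUltrametricDist K] [ProperSpace K]

omit [NormedAlgebra ℚ_[2] K] [IsUltrametricDist K] [ProperSpace K] in
/-- **ROWS `(H, l) = (2, 53)`** (the three `v₂(abc) = 5` triples of WINDOW-TABLE v4.54 at `l = 53`; `e₀ = 2·3·5·53 = 1590`, bracket `{1590, 3180}`,
turning points `11`, `12`): the sharp `hlt` HOLDS at both ends — `8·53·(b♯ + 2) = 4965.8… / 5389.8… < 50·54·2 = 5400` (v1: `8·53·(b_e + 2) =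
5511.7… / 5935.8… ≮ 5400`, UNDECIDED). [claim: Mochizuki2012, status: disputed] -/
theorem hlt_sharp_H2_l53 {e a₀ : ℕ} (he : (e = 1590 ∧ a₀ = 11) ∨ (e = 3180 ∧ a₀ = 12)) :
    8 * ((53 : ℕ) : ℝ) * (((a₀ : ℝ) - (2 : ℝ) ^ a₀ / (e : ℝ)) + 2) < (((53 : ℕ) : ℝ) - 3) * (((53 : ℕ) : ℝ) + 1) * (2 : ℝ) := by
  rcases he with ⟨rfl, rfl⟩ | ⟨rfl, rfl⟩ <;> norm_num

/-- **`(H, l) = (2, 53)` as a field-level theorem**: for EVERY 2-adic field `K` with `e(K/ℚ₂) ∈ {1590, 3180}` and EVERY `q ∈ K` with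
`‖q‖^{2·53} = 2^{−2}`: `q ∉ q^{26²}·ℐ_K` (top label `l⋇ = 26`). [cite: MochizukiAbsTopIII2015, Def 5.4 (iii) p. 126] -/
theorem not_mem_topLabel_H2_l53 (he : absRamificationIdx 2 K = 1590 ∨ absRamificationIdx 2 K = 3180) {q : K}
    (hqN : ‖q‖ ^ (2 * (2 * 26 + 1)) = ((2 : ℕ) : ℝ) ^ (-(2 : ℝ))) :
    q ∉ q ^ (26 ^ 2) • logShell (PadicLogOnUnits.ofUnitLog 2 K) := by
  rcases he with he | he
  · obtain ⟨hlo, hhi⟩ := turning_two (e := 1590) (k := 10) (by norm_num) (by norm_num)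
    rw [← he] at hlo hhi
    refine not_mem_topLabel_of_large_l_sharp 2 K hlo hhi 26 hqN ?_
    rw [pstarExp_two, he, Nat.cast_ofNat]
    exact hlt_sharp_H2_l53 (Or.inl ⟨rfl, rfl⟩)
  · obtain ⟨hlo, hhi⟩ := turning_two (e := 3180) (k := 11) (by norm_num) (by norm_num)
    rw [← he] at hlo hhi
    refine not_mem_topLabel_of_large_l_sharp 2 K hlo hhi 26 hqN ?_
    rw [pstarExp_two, he, Nat.cast_ofNat]
    exact hlt_sharp_H2_l53 (Or.inr ⟨rfl, rfl⟩)

omit [NormedAlgebra ℚ_[2] K] [IsUltrametricDist K] [ProperSpace K] in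
/-- **ROWS `(H, l) = (8, 13)`** (the two `H = 8` triples `283 + 5¹¹·13² = 2⁸·3⁸·17³` (pole) and `19·1307 + 7·29²·31⁸ = 2⁸·3²²·5⁴` at `l = 13`;
`e₀ = 2·3·5·13 = 390`, bracket `{390, 780}`, turning points `9`, `10`): sharp `hlt` HOLDS at both ends — `8·13·(b♯ + 2) = 1007.4… / 1111.4… <
10·14·8 = 1120` (v1: `1143.7… / 1247.8… ≮ 1120`, UNDECIDED). [claim: Mochizuki2012, status: disputed] -/
theorem hlt_sharp_H8_l13 {e a₀ : ℕ} (he : (e = 390 ∧ a₀ = 9) ∨ (e = 780 ∧ a₀ = 10)) :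
    8 * ((13 : ℕ) : ℝ) * (((a₀ : ℝ) - (2 : ℝ) ^ a₀ / (e : ℝ)) + 2) < (((13 : ℕ) : ℝ) - 3) * (((13 : ℕ) : ℝ) + 1) * (8 : ℝ) := by
  rcases he with ⟨rfl, rfl⟩ | ⟨rfl, rfl⟩ <;> norm_num

/-- **`(H, l) = (8, 13)` as a field-level theorem**: for EVERY 2-adic `K` with `e(K/ℚ₂) ∈ {390, 780}` and EVERY `q` with `‖q‖^{26} = 2^{−8}`:
`q ∉ q^{36}·ℐ_K` (top label `l⋇ = 6`). [cite: MochizukiAbsTopIII2015, Def 5.4 (iii) p. 126] -/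
theorem not_mem_topLabel_H8_l13 (he : absRamificationIdx 2 K = 390 ∨ absRamificationIdx 2 K = 780) {q : K}
    (hqN : ‖q‖ ^ (2 * (2 * 6 + 1)) = ((2 : ℕ) : ℝ) ^ (-(8 : ℝ))) :
    q ∉ q ^ (6 ^ 2) • logShell (PadicLogOnUnits.ofUnitLog 2 K) := by
  rcases he with he | he
  · obtain ⟨hlo, hhi⟩ := turning_two (e := 390) (k := 8) (by norm_num) (by norm_num)
    rw [← he] at hlo hhi
    refine not_mem_topLabel_of_large_l_sharp 2 K hlo hhi 6 hqN ?_
    rw [pstarExp_two, he, Nat.cast_ofNat]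
    exact hlt_sharp_H8_l13 (Or.inl ⟨rfl, rfl⟩)
  · obtain ⟨hlo, hhi⟩ := turning_two (e := 780) (k := 9) (by norm_num) (by norm_num)
    rw [← he] at hlo hhi
    refine not_mem_topLabel_of_large_l_sharp 2 K hlo hhi 6 hqN ?_
    rw [pstarExp_two, he, Nat.cast_ofNat]
    exact hlt_sharp_H8_l13 (Or.inr ⟨rfl, rfl⟩)

/-- **A row that STAYS undecided under the sharp face**: big Frey triple (`H = 2`) at `l = 13`, small end `e_w = 390` (turning point `9`):
`8·13·(b♯₃₉₀ + 2) = 104·(11 − 512/390) = 1007.4… ≮ (13−3)(13+1)·2 = 280` — the cell lies inside the sharp window `1 ≤ (l⋇²−1)·H/(2l) ≤ 2 + b♯`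
(here `35·2/26 = 2.69…`), which no norm-only face decides (`logUnits_subset_pBall_neg_iff_sharp`). [claim: Mochizuki2012, status: disputed] -/
theorem not_hlt_sharp_bigFrey_l13 :
    ¬ 8 * ((13 : ℕ) : ℝ) * ((((9 : ℕ) : ℝ) - (2 : ℝ) ^ (9 : ℕ) / ((390 : ℕ) : ℝ)) + 2) < (((13 : ℕ) : ℝ) - 3) * (((13 : ℕ) : ℝ) + 1) * (2 : ℝ) := by
  norm_num

/-- **The two BRACKET-DEPENDENT rows of v2** (sharp `hlt` holds at `e₀`, fails at `2e₀`; by (S2) they stay UNDECIDED until the wild part `2^α` of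
`e_w` is pinned): `2⁷·23⁸ + 19⁹·857² = 3²²·13·47²·263` at `l = 13`, `H = 6`, `{130, 260}` (turning `8`, `9`): `835.2 < 840` but `939.2 ≮ 840`;
`2¹²·13³·223³ + 3¹⁵·11³·97⁵·409 = 5¹⁵·179⁴·2141` at `l = 7`, `H = 16`, `{210, 420}` (turning `8`, `9`): `491.7… < 512` but `547.7… ≮ 512`.
[claim: Mochizuki2012, status: disputed] -/
theorem hlt_sharp_bracketDependent :
    (8 * ((13 : ℕ) : ℝ) * ((((8 : ℕ) : ℝ) - (2 : ℝ) ^ (8 : ℕ) / ((130 : ℕ) : ℝ)) + 2) < (((13 : ℕ) : ℝ) - 3) * (((13 : ℕ) : ℝ) + 1) * (6 : ℝ) ∧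
      ¬ 8 * ((13 : ℕ) : ℝ) * ((((9 : ℕ) : ℝ) - (2 : ℝ) ^ (9 : ℕ) / ((260 : ℕ) : ℝ)) + 2) < (((13 : ℕ) : ℝ) - 3) * (((13 : ℕ) : ℝ) + 1) * (6 : ℝ)) ∧
    (8 * ((7 : ℕ) : ℝ) * ((((8 : ℕ) : ℝ) - (2 : ℝ) ^ (8 : ℕ) / ((210 : ℕ) : ℝ)) + 2) < (((7 : ℕ) : ℝ) - 3) * (((7 : ℕ) : ℝ) + 1) * (16 : ℝ) ∧
      ¬ 8 * ((7 : ℕ) : ℝ) * ((((9 : ℕ) : ℝ) - (2 : ℝ) ^ (9 : ℕ) / ((420 : ℕ) : ℝ)) + 2) < (((7 : ℕ) : ℝ) - 3) * (((7 : ℕ) : ℝ) + 1) * (16 : ℝ)) := by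
  norm_num

end Rows

end Summit.ABC.IUTFork.Repair.Mu6TwoAdicSharpFace

end
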